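/-
Copyright (c) 2026. All rights reserved.
Released under Apache 2.0 license as described in the file LICENSE.
Authors: abc-iut cell, prover seat abc-iut-L4-t11 (gen 15; cell row «T10-4 CONTACT-OBS@⋉-CARRIERS», L4-lead m191 (2)), over
abc-iut-w4-d095's (c)-clause sufficiency theorem re-elaborated over `⋉` (`Ltimes/LogFrobeniusMonoTelecoreContactObservables.lean`),
abc-iut-L4-t8's two-sided `⋉`-carrier (`Ltimes/LogFrobeniusSettingSumLtimesCarriers.lean`), abc-iut-L4-t3's restriction
`toLtimes` (S1b) and restricted coherence data, abc-iut-f-101's genuine open-augmentation carrier; everything consumed BY NAME.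
-/
import Literature.AnabelianGeometry.AbsoluteAnabelian.Ltimes.LogFrobeniusMonoTelecoreContactObservables
import Literature.AnabelianGeometry.AbsoluteAnabelian.Ltimes.LogFrobeniusSettingSumLtimesCarriers
import Literature.AnabelianGeometry.AbsoluteAnabelian.LogFrobeniusMonoGenuineSubIotaOver
import Literature.AnabelianGeometry.AbsoluteAnabelian.LogFrobeniusMonoGenuineIotaOverTS
import HarnessLib

/-!
# [AbsTopIII] Cor 5.10 (iv)(c), observable clause (`s_c′`), at the `⋉`-CARRIERS: the restricted genuine open carrier and the two-sided carrier

S. Mochizuki, *Topics in absolute anabelian geometry III: global reconstruction algorithms*, J. Math. Sci. Univ. Tokyo 22 (2015)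
939–1156 [MochizukiAbsTopIII2015]; manuscript `paper:url-5493eb38cbb7`, read on the page (own render): Cor 5.10 (iv)(c) p. 148
l. 39–51 («a contact structure `ℋ_{An⊢}` on `𝔗_{An⊢}` that is compatible with the telecore and contact structures `𝔗_{An•}`,
`ℋ_{An•}` of Corollary 5.5, (ii), as well as with the homotopies on the portion of `D_{An⊢}` indexed by `v` that arise from the
observables `S_log`, `S_log⊞` of Corollary 5.5, (iii)»), Cor 5.10 (iv) p. 147 l. 29 («If `v ∈ V(F_mod)^non` (respectively,
`v ∈ V(F_mod)^arc`)» — one picture over ALL of `V(F_mod)`), Def 5.4 (iv)/(vii) pp. 127–128 (`ι⊞` over `Th•[Z]`).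

WHY THIS FILE (cell row «T10-4», L4-lead m191 (2); DELTA #4 input `s_c′` at the setting of record).  abc-iut-w5-d144's typed
(c)-clause `Cor510MonoContactObservablesCompatible` has, over the `⋉`-successor interface, the SUFFICIENCY theorem
`MonoTelecoreCoherence.cor510MonoContactObservablesCompatible_of` (abc-iut-w4-d095, re-elaborated over `⋉` by this seat): inputs a
coherence datum `K`, `ι^{An⊢⊞}`-data `I` with its square, the `η⊢`-square, `IotaOver`, a `TS`-datum and the two Cor 5.5 (iii)
observable structures.  THIS PROOF-ONLY FILE feeds it BY NAME at the two `⋉`-carriers of record: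
* §1 transfers along abc-iut-L4-t3's restriction `toLtimes` (definitional bookkeeping): `toLtimes_twistOver`, `toLtimes_lamTwistOver`,
  ★ `IotaOver.toLtimes` (the `ι⊞`-over-`Th•[Z]` add-on of a frozen carrier restricts), `TSHomotopies.toLtimes` (a frozen `TS`-datum
  restricts: same `ι_{v,ε}`, the `⋉`-compatibility is S1b's `TSHomotopies_iota_toTS`);
* §2 at abc-iut-f-101's genuine open carrier read over `⋉`, `(genuineOpen p V).toLtimes`: `iotaOver_openLtimes` (abc-iut-w5-d144's
  `nonarchGenuineMonoAnPfOpen_iotaOver` restricted), ★ `cor510MonoContactObservablesCompatible_openLtimes_of` — the (c)-clause from the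
  two OBSERVABLE STRUCTURES ONLY (`K`, `I`, both squares, `IotaOver` discharged by name: abc-iut-L4-t8's `iotaData_openLtimes` /
  `squaresCommute_openLtimes` / `etaNatural_openLtimes`, abc-iut-L4-t3's `monoTelecoreCoherence_openLtimes`), and its `_iff_nonempty`;
* §3 at THE SETTING OF RECORD, abc-iut-L4-t8's two-sided carrier `genuineTwoSidedSumLtimes p 𝔄 V₁ V₂` (nonarchimedean AND archimedean
  places in ONE `⋉`-setting): ★ `genuineTwoSidedSumLtimes_cor510MonoContactObservablesCompatible_of` — the (c)-clause from `IotaOver` of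
  the two-sided carrier + a `TS`-datum + the two observable structures (+ the orientation cochain for a general `𝔄`; `K`, `I` and both
  squares discharged by name from `Ltimes/LogFrobeniusSettingSumLtimesCarriers.lean`), its cochain-free GEOMETRIC form
  `HolRS.cor510MonoContactObservablesCompatible_genuineTwoSidedSumLtimes_geometric_of` and the `_iff_nonempty`.
BINDERS REMAINING (honest; the DELTA #4 reader lists them): at both carriers the `TS`-datum and the two Cor 5.5 (iii) observable
structures `Cor55Observables` / `Cor55ObservablesTS` over `⋉` (the outputs of abc-iut-f-101's «T9-E»; at the restricted open carrier
they are the frozen genuine observables read along `toLtimes`), and at the two-sided carrier additionally `IotaOver` of the sum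
(summand-wise glue not yet in the tree).  MODEL-LEVEL (carriers of OUR successor typing); refereed pre-IUT material; nothing here bears
on [IUTchIII] Cor. 3.12; no side taken; instantiated ≠ endorsed; typed ≠ proved.
-/

set_option autoImplicit false

universe u

open CategoryTheory

namespace Literature.AnabelianGeometry.AbsoluteAnabelian

/-! ## §1. Transfers along `toLtimes` -/

namespace LogFrobeniusSetting

variable {Vmod : Type u} {isArc : Vmod → Bool} (L : LogFrobeniusSetting Vmod isArc)

/-- `toLtimes` keeps the structure isomorphism "`Λ_ν` lies over `Th•[Z]`" (`twistOver`). [cite: MochizukiAbsTopIII2015, Def 5.4 (iv) p. 127] -/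
theorem toLtimes_twistOver (b : Bool) : L.toLtimes.twistOver b = L.twistOver b := by
  cases b <;> rfl

/-- `toLtimes` keeps "`λ_{v,ν} ∘ Λ_ν` lies over `Th•[Z]`" (`lamTwistOver`). [cite: MochizukiAbsTopIII2015, Def 5.4 (iv) p. 127] -/
theorem toLtimes_lamTwistOver (v : Vmod) (ν : LogVertex (isArc v)) :
    L.toLtimes.lamTwistOver v ν = L.lamTwistOver v ν := by
  change Functor.associator _ _ _ ≪≫ Functor.isoWhiskerLeft _ (L.lamOver v ν) ≪≫ L.toLtimes.twistOver ν.isPostLog = _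
  rw [toLtimes_twistOver]
  rfl

/-- ★ **the add-on `IotaOver` restricts along `toLtimes`**: if the `ι⊞_{v,ε}` of a frozen carrier lie over `Th•[Z]` along every
edge of `Γ⃗^log_v`, then so do those of its `⋉`-restriction along every edge of `Γ⃗^⋉_v` (the same natural transformations, read on
the sub-family of edges). [cite: MochizukiAbsTopIII2015, Def 5.4 (vii) p. 128] -/
theorem IotaOver.toLtimes (h : L.IotaOver) : L.toLtimes.IotaOver := by
  intro v ν₁ ν₂ ε
  rw [toLtimes_lamTwistOver]
  exact h v ε.toOld

/-- **a frozen `TS`-datum restricts along `toLtimes`**: the same `ι_{v,ε}` on every edge of `Γ⃗^log_v`; on `Γ⃗^⋉_v` it is the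
restricted `ι⊞` pushed down to `𝒩_v` (S1b's `TSHomotopies_iota_toTS`). [cite: MochizukiAbsTopIII2015, Def 5.4 (vii) p. 128] -/
def TSHomotopies.toLtimes (T : L.TSHomotopies) : L.toLtimes.TSHomotopies where
  iota v _ _ ε := T.iota v ε
  iota_toTS v _ _ ε := by
    rw [TSHomotopies_iota_toTS]
    rfl

/-- the restricted `TS`-datum has the same `ι_{v,ε}`. [cite: MochizukiAbsTopIII2015, Def 5.4 (vii) p. 128] -/
@[simp] theorem TSHomotopies.toLtimes_iota (T : L.TSHomotopies) (v : Vmod) {ν₁ ν₂ : LogVertex (isArc v)}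
    (ε : LogEdgeTS (isArc v) ν₁ ν₂) : (T.toLtimes).iota v ε = T.iota v ε := rfl

end LogFrobeniusSetting

/-! ## §2. The (c)-clause at the genuine open-augmentation carrier read over `⋉` -/

namespace LogFrobeniusSetting

open AbsTopIII

variable (p : ℕ) [Fact p.Prime] (Vmod : Type 1)

/-- abc-iut-w5-d144's genuine `IotaOver` at `genuineOpen p V`, read over `⋉` along `toLtimes`. [cite: MochizukiAbsTopIII2015, Def 5.4 (vii) p. 128] -/
theorem iotaOver_openLtimes : (genuineOpen p Vmod).toLtimes.IotaOver :=
  (nonarchGenuineMonoAnPfOpen_iotaOver p Vmod (fun _ => false)).toLtimes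

/-- ★ **Cor 5.10 (iv)(c), observable clause, at `(genuineOpen p V).toLtimes` FROM THE OBSERVABLE STRUCTURES ONLY** (`V ≠ ∅`):
for every `TS`-datum over the restricted carrier and any Cor 5.5 (iii) observable structures `S_log⊞`, `S_log` over `⋉`, the
(c)-clause holds — the coherence datum (abc-iut-L4-t3's `monoTelecoreCoherence_openLtimes`), the genuine `ι^{An⊢⊞}`-data with its
square and the `η⊢`-square (abc-iut-L4-t8's `iotaData_openLtimes` / `squaresCommute_openLtimes` / `etaNatural_openLtimes`) and
`IotaOver` (`iotaOver_openLtimes`) are fed BY NAME to abc-iut-w4-d095's sufficiency theorem over `⋉`.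
[cite: MochizukiAbsTopIII2015, Cor 5.10 (iv)(c) p. 148] -/
theorem cor510MonoContactObservablesCompatible_openLtimes_of [Nonempty Vmod] (TS : (genuineOpen p Vmod).toLtimes.TSHomotopies)
    (hplus : (genuineOpen p Vmod).toLtimes.Cor55Observables) (hts : (genuineOpen p Vmod).toLtimes.Cor55ObservablesTS TS) :
    (genuineOpen p Vmod).toLtimes.Cor510MonoContactObservablesCompatible TS :=
  (monoTelecoreCoherence_openLtimes p Vmod).cor510MonoContactObservablesCompatible_of (iotaData_openLtimes p Vmod)
    (squaresCommute_openLtimes p Vmod) (etaNatural_openLtimes p Vmod) (iotaOver_openLtimes p Vmod) TS hplus hts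

/-- … EXACTLY iff `V ≠ ∅` (abc-iut-w5-d144's degenerate corner, over `⋉`). [cite: MochizukiAbsTopIII2015, Cor 5.10 (iv)(c) p. 148] -/
theorem cor510MonoContactObservablesCompatible_openLtimes_iff_nonempty (TS : (genuineOpen p Vmod).toLtimes.TSHomotopies)
    (hplus : (genuineOpen p Vmod).toLtimes.Cor55Observables) (hts : (genuineOpen p Vmod).toLtimes.Cor55ObservablesTS TS) :
    (genuineOpen p Vmod).toLtimes.Cor510MonoContactObservablesCompatible TS ↔ Nonempty Vmod :=
  (monoTelecoreCoherence_openLtimes p Vmod).cor510MonoContactObservablesCompatible_iff_nonempty (iotaData_openLtimes p Vmod)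
    (squaresCommute_openLtimes p Vmod) (etaNatural_openLtimes p Vmod) (iotaOver_openLtimes p Vmod) TS hplus hts

/-- the frozen carrier's own `TS`-datum, restricted: a `TS`-datum over `(genuineOpen p V).toLtimes` EXISTS (the `TS` binder above is
inhabited). [cite: MochizukiAbsTopIII2015, Def 5.4 (vii) p. 128] -/
theorem nonempty_TSHomotopies_openLtimes : Nonempty (genuineOpen p Vmod).toLtimes.TSHomotopies :=
  ⟨(genuineOpenTS p Vmod).toLtimes⟩

end LogFrobeniusSetting

/-! ## §3. The (c)-clause at the SETTING OF RECORD: the two-sided `⋉`-carrier -/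

namespace LogFrobeniusSettingLtimes

open LogFrobeniusSetting AbsTopIII

section TwoSided

variable (p : ℕ) [Fact p.Prime] (𝔄 : AutHolFieldFunctor.{0}) (V₁ V₂ : Type 1)

/-- ★ **Cor 5.10 (iv)(c), observable clause, AT THE TWO-SIDED `⋉`-CARRIER `genuineTwoSidedSumLtimes p 𝔄 V₁ V₂`** (`V₁ ⊕ V₂ ≠ ∅`),
under the orientation cochain of `𝔄`: from `IotaOver` of the two-sided carrier, a `TS`-datum and the two Cor 5.5 (iii) observable
structures over `⋉`, the (c)-clause holds — the summand-wise coherence datum, `ι^{An⊢⊞}`-data, `ι`-square and `η⊢`-square of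
abc-iut-L4-t8's carrier file are fed BY NAME to abc-iut-w4-d095's sufficiency theorem over `⋉`.
[cite: MochizukiAbsTopIII2015, Cor 5.10 (iv)(c) p. 148] -/
theorem genuineTwoSidedSumLtimes_cor510MonoContactObservablesCompatible_of [Nonempty (V₁ ⊕ V₂)] (c : 𝔄.EA → ℝ)
    (hc : ∀ X : 𝔄.EA, c X = 1 ∨ c X = -1)
    (hcob : ∀ {X Y : 𝔄.EA} (f : X ⟶ Y), AutHolFieldFunctor.transitionSign f = c X * c Y)
    (hιO : (genuineTwoSidedSumLtimes p 𝔄 V₁ V₂).IotaOver) (TS : (genuineTwoSidedSumLtimes p 𝔄 V₁ V₂).TSHomotopies)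
    (hplus : (genuineTwoSidedSumLtimes p 𝔄 V₁ V₂).Cor55Observables)
    (hts : (genuineTwoSidedSumLtimes p 𝔄 V₁ V₂).Cor55ObservablesTS TS) :
    (genuineTwoSidedSumLtimes p 𝔄 V₁ V₂).Cor510MonoContactObservablesCompatible TS :=
  (genuineTwoSidedSumLtimes_monoTelecoreCoherence p 𝔄 V₁ V₂ c hc hcob).cor510MonoContactObservablesCompatible_of
    (genuineTwoSidedSumLtimes_iotaData p 𝔄 V₁ V₂ c hc hcob) (genuineTwoSidedSumLtimes_squaresCommute p 𝔄 V₁ V₂)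
    (genuineTwoSidedSumLtimes_etaNatural p 𝔄 V₁ V₂ c hc hcob) hιO TS hplus hts

/-- … and at the two-sided carrier the (c)-clause holds EXACTLY iff `V₁ ⊕ V₂ ≠ ∅` (given the same inputs).
[cite: MochizukiAbsTopIII2015, Cor 5.10 (iv)(c) p. 148] -/
theorem genuineTwoSidedSumLtimes_cor510MonoContactObservablesCompatible_iff_nonempty (c : 𝔄.EA → ℝ)
    (hc : ∀ X : 𝔄.EA, c X = 1 ∨ c X = -1)
    (hcob : ∀ {X Y : 𝔄.EA} (f : X ⟶ Y), AutHolFieldFunctor.transitionSign f = c X * c Y)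
    (hιO : (genuineTwoSidedSumLtimes p 𝔄 V₁ V₂).IotaOver) (TS : (genuineTwoSidedSumLtimes p 𝔄 V₁ V₂).TSHomotopies)
    (hplus : (genuineTwoSidedSumLtimes p 𝔄 V₁ V₂).Cor55Observables)
    (hts : (genuineTwoSidedSumLtimes p 𝔄 V₁ V₂).Cor55ObservablesTS TS) :
    (genuineTwoSidedSumLtimes p 𝔄 V₁ V₂).Cor510MonoContactObservablesCompatible TS ↔ Nonempty (V₁ ⊕ V₂) :=
  (genuineTwoSidedSumLtimes_monoTelecoreCoherence p 𝔄 V₁ V₂ c hc hcob).cor510MonoContactObservablesCompatible_iff_nonempty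
    (genuineTwoSidedSumLtimes_iotaData p 𝔄 V₁ V₂ c hc hcob) (genuineTwoSidedSumLtimes_squaresCommute p 𝔄 V₁ V₂)
    (genuineTwoSidedSumLtimes_etaNatural p 𝔄 V₁ V₂ c hc hcob) hιO TS hplus hts

end TwoSided

end LogFrobeniusSettingLtimes

/-! ## §3b. The geometric case: no cochain -/

namespace HolRS

open LogFrobeniusSetting LogFrobeniusSettingLtimes

/-- ★ **at the geometric Aut-holomorphic field functor of any class `Q` of hyperbolic Riemann surfaces the cochain is dispensable**
(`exists_orientationCochain_geometric`): Cor 5.10 (iv)(c), observable clause, at the two-sided `⋉`-carrier from `IotaOver`, a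
`TS`-datum and the two observable structures ONLY (`V₁ ⊕ V₂ ≠ ∅`). [cite: MochizukiAbsTopIII2015, Cor 5.10 (iv)(c) p. 148] -/
theorem cor510MonoContactObservablesCompatible_genuineTwoSidedSumLtimes_geometric_of (p : ℕ) [Fact p.Prime]
    (Q : ObjectProperty HolRS) (V₁ V₂ : Type 1) [Nonempty (V₁ ⊕ V₂)]
    (hιO : (genuineTwoSidedSumLtimes p (geometricAutHolFieldFunctor Q) V₁ V₂).IotaOver)
    (TS : (genuineTwoSidedSumLtimes p (geometricAutHolFieldFunctor Q) V₁ V₂).TSHomotopies)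
    (hplus : (genuineTwoSidedSumLtimes p (geometricAutHolFieldFunctor Q) V₁ V₂).Cor55Observables)
    (hts : (genuineTwoSidedSumLtimes p (geometricAutHolFieldFunctor Q) V₁ V₂).Cor55ObservablesTS TS) :
    (genuineTwoSidedSumLtimes p (geometricAutHolFieldFunctor Q) V₁ V₂).Cor510MonoContactObservablesCompatible TS := by
  obtain ⟨c, hc, hcob⟩ := exists_orientationCochain_geometric Q
  exact genuineTwoSidedSumLtimes_cor510MonoContactObservablesCompatible_of p _ V₁ V₂ c hc hcob hιO TS hplus hts

end HolRS

end Literature.AnabelianGeometry.AbsoluteAnabelian
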